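import Summits.Ventures.LatticeQCDFlow.Exactness.IMHAnyStartSplit
import HarnessLib

/-!
# Every start: the burn-in law of flow-MCMC from ANY initial law — the time-average bias after `b` discarded updates is
# at most `(range of f)·r^b·S_N/N`; no start over-estimates an observable maximal at the mode more than the cold start

HONEST FRAMING: exact (Metropolis-corrected) sampling algorithms for lattice gauge theory;
figures of merit are autocorrelation/cost numbers at stated couplings and volumes; no
continuum-physics claim.

Venture `LatticeQCDFlow` (cell pub-lqcd), topic `Exactness`; FANOUT row 30 (lean-1, GEN-34).  NEW WORK of the
cell, general state space.  GEN-31 (`Exactness/IMHColdStartBurnIn`, `…Discard`, `…PathAverage`) computed the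
time-average bias of the flow-MCMC chain `K = indepMH q w` started AT A MODE `x₀` of the normalised weight `w`
EXACTLY: `Σ_{b ≤ t < b+N}(E_{x₀} f(X_t) − π f) = (f(x₀) − π f)·r^b·S_N`, `S_N = Σ_{t<N} r^t = w(x₀)(1 − r^N)`,
`r = 1 − 1/w(x₀)`, and recorded the tree's any-start certificate `2(C + |π f|)·w(x₀)/N` (Doeblin, `Scoring/ChainBurnIn`).
With the exact split `μ₀K^t = (1 − r^t)·π + r^t·μ₀R^t` of `Exactness/IMHAnyStartSplit` (this generation) the any-start
law takes the same SHAPE as the cold-start law, with the range of `f` in place of its cold offset: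

* §1 **`sum_Ico_integral_iterate_bind_indepMH_sub_mem_Icc`** — for every initial law `μ₀`, measurable `f` with
  `a ≤ f ≤ c`, every `b, N`: `Σ_{b ≤ t < b+N}(E_{μ₀} f(X_t) − π f) ∈ [(a − π f)·r^b·S_N, (c − π f)·r^b·S_N]`; hence
  (**`abs_sum_Ico_integral_iterate_bind_indepMH_sub_le`**) `|Σ_{b ≤ t < b+N} bias_t| ≤ max(π f − a, c − π f)·r^b·S_N
  ≤ max(π f − a, c − π f)·r^b·min(N, w(x₀))` — against the cold start's EXACT `|f(x₀) − π f|·r^b·S_N`.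
* §2 on path space (Mathlib `Kernel.trajMeasure`): **`imh_chain_windowAverage_bias_anyStart_mem_Icc`** —
  `E_{μ₀}[(1/N)Σ_{i<N} f(X_{b+i})] − π f ∈ [(a − π f)·r^b·S_N/N, (c − π f)·r^b·S_N/N]` (`N ≥ 1`), so
  (**`imh_chain_windowAverage_bias_anyStart_abs_le`**) `|…| ≤ max(π f − a, c − π f)·r^b·min(1, w(x₀)/N)`: FROM EVERY
  START THE TIME-AVERAGE BIAS DECAYS LIKE `w(x₀)/N = 1/(N·A)` TIMES `r^b` — the any-start certificate with its constant
  made exact (`max(π f − a, c − π f) ≤ c − a` replaces `2(C + |π f|)`, and the factor `(1 − r^N)` is kept);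
  **`imh_chain_windowAverage_bias_anyStart_abs_le_of_log_le`** — `log(1/ε) ≤ b/w(x₀)` discarded updates leave
  `≤ ε·max(π f − a, c − π f)`, for every window length, from every start.
* §3 **`imh_chain_windowAverage_bias_anyStart_le_cold`** — NO START OVER-ESTIMATES AN OBSERVABLE MAXIMAL AT THE
  MODE MORE THAN THE COLD START: if `f ≤ f(x₀)` (the plaquette, minus the action, every monotone function of the
  weight) then for every start `E_{μ₀}[window average] − π f ≤ E_{x₀}[window average] − π f = (f(x₀) − π f)·r^b·S_N/N`
  (**`imh_chain_windowAverage_bias_mode_eq`**, GEN-31 on path space) — GEN-31's exact cold-start bias is the largest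
  signed bias over all initial laws; mirror form **`…_ge_cold`** for observables minimal at the mode.

Reading (gauge files): from EVERY start — hot, mixed, adversarial — the bias of a window average of an observable
with range `c − a` is at most `(c − a)(1 − A)^b·min(1, 1/(N·A))`, and `b·A ≥ log(1/ε)` discarded configurations
suffice for all starts at once; the plaquette is maximal at the cold configuration, so no start over-estimates the
mean plaquette more than the cold start's exact `(P(cold) − ⟨P⟩)(1 − A)^b S_N/N`.
NOT CLAIMED: the sign of the bias from a non-modal start; that the cold start maximises the ABSOLUTE bias (a start
concentrated where `f` is small can under-estimate by up to `(π f − a)·r^b·S_N/N`); mean-square errors from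
non-modal starts (the Scoring row's any-start certificate applies; GEN-32 for the cold start).

No `sorry`, no new definitions, nothing cited as a fact; general measurable space.
-/

noncomputable section

namespace Summit.Ventures.LatticeQCDFlow.Exactness

open MeasureTheory ProbabilityTheory Function Finset
open scoped ENNReal
open Summit.Ventures.LatticeQCDFlow.Scoring Literature.Probability.MarkovChains

variable {Ω : Type*} [MeasurableSpace Ω] {q : Measure Ω} [IsProbabilityMeasure q] {w : Ω → ℝ}

/-! ## §1 Window sums of one-time biases from every start -/

/-- **WINDOW SUMS FROM EVERY START**: for measurable `f` with `a ≤ f ≤ c` and every initial law,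
`Σ_{b ≤ t < b+N}(E_{μ₀} f(X_t) − π f) ∈ [(a − π f)·r^b·S_N, (c − π f)·r^b·S_N]`. [ours] -/
theorem sum_Ico_integral_iterate_bind_indepMH_sub_mem_Icc (hw : Measurable w) (hw0 : ∀ y, 0 < w y) {x₀ : Ω}
    (hmax : ∀ y, w y ≤ w x₀) [IsProbabilityMeasure (q.withDensity fun y => ENNReal.ofReal (w y))]
    (μ₀ : Measure Ω) [IsProbabilityMeasure μ₀] {f : Ω → ℝ} (hf : Measurable f) {a c : ℝ}
    (ha : ∀ x, a ≤ f x) (hc : ∀ x, f x ≤ c) (b N : ℕ) :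
    ∑ t ∈ Ico b (b + N), (∫ x, f x ∂((fun m : Measure Ω => m.bind (indepMH q w))^[t] μ₀) -
        ∫ x, f x ∂(q.withDensity fun y => ENNReal.ofReal (w y))) ∈
      Set.Icc ((a - ∫ x, f x ∂(q.withDensity fun y => ENNReal.ofReal (w y))) *
          ((1 - (w x₀)⁻¹) ^ b * ∑ t ∈ range N, (1 - (w x₀)⁻¹) ^ t))
        ((c - ∫ x, f x ∂(q.withDensity fun y => ENNReal.ofReal (w y))) *
          ((1 - (w x₀)⁻¹) ^ b * ∑ t ∈ range N, (1 - (w x₀)⁻¹) ^ t)) := by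
  rw [Finset.sum_Ico_eq_sum_range, Nat.add_sub_cancel_left, mul_sum, mul_sum, mul_sum]
  constructor
  · refine sum_le_sum fun t _ => ?_
    have h := (integral_iterate_bind_indepMH_mem_Icc (q := q) hw hw0 hmax (b + t) μ₀ hf ha hc).1
    rw [pow_add] at h
    linarith
  · refine sum_le_sum fun t _ => ?_
    have h := (integral_iterate_bind_indepMH_mem_Icc (q := q) hw hw0 hmax (b + t) μ₀ hf ha hc).2
    rw [pow_add] at h
    linarith

/-- **`|Σ_{b ≤ t < b+N} bias_t| ≤ max(π f − a, c − π f)·r^b·S_N`** from every start. [ours] -/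
theorem abs_sum_Ico_integral_iterate_bind_indepMH_sub_le (hw : Measurable w) (hw0 : ∀ y, 0 < w y) {x₀ : Ω}
    (hmax : ∀ y, w y ≤ w x₀) [IsProbabilityMeasure (q.withDensity fun y => ENNReal.ofReal (w y))]
    (μ₀ : Measure Ω) [IsProbabilityMeasure μ₀] {f : Ω → ℝ} (hf : Measurable f) {a c : ℝ}
    (ha : ∀ x, a ≤ f x) (hc : ∀ x, f x ≤ c) (b N : ℕ) :
    |∑ t ∈ Ico b (b + N), (∫ x, f x ∂((fun m : Measure Ω => m.bind (indepMH q w))^[t] μ₀) -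
        ∫ x, f x ∂(q.withDensity fun y => ENNReal.ofReal (w y)))| ≤
      max (∫ x, f x ∂(q.withDensity fun y => ENNReal.ofReal (w y)) - a)
          (c - ∫ x, f x ∂(q.withDensity fun y => ENNReal.ofReal (w y))) *
        ((1 - (w x₀)⁻¹) ^ b * ∑ t ∈ range N, (1 - (w x₀)⁻¹) ^ t) := by
  obtain ⟨h1, h2⟩ := sum_Ico_integral_iterate_bind_indepMH_sub_mem_Icc (q := q) hw hw0 hmax μ₀ hf ha hc b N
  have hW : 1 ≤ w x₀ := one_le_of_mode (q := q) hmax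
  have hr0 : 0 ≤ 1 - (w x₀)⁻¹ := sub_nonneg.2 (inv_le_one_of_one_le₀ hW)
  have hS0 : 0 ≤ (1 - (w x₀)⁻¹) ^ b * ∑ t ∈ range N, (1 - (w x₀)⁻¹) ^ t :=
    mul_nonneg (pow_nonneg hr0 b) (sum_nonneg fun t _ => pow_nonneg hr0 t)
  set m := ∫ x, f x ∂(q.withDensity fun y => ENNReal.ofReal (w y))
  have hm1 := mul_le_mul_of_nonneg_right (le_max_left (m - a) (c - m)) hS0
  have hm2 := mul_le_mul_of_nonneg_right (le_max_right (m - a) (c - m)) hS0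
  rw [abs_le]
  constructor <;> nlinarith

/-- For `a ≤ f ≤ c` measurable and a probability law: `a ≤ ∫ f ≤ c`. [ours, bookkeeping] -/
theorem integral_mem_Icc_of_bounds (μ : Measure Ω) [IsProbabilityMeasure μ] {f : Ω → ℝ} (hf : Measurable f)
    {a c : ℝ} (ha : ∀ x, a ≤ f x) (hc : ∀ x, f x ≤ c) : ∫ x, f x ∂μ ∈ Set.Icc a c := by
  have hC : ∀ x, |f x| ≤ max |a| |c| := fun x => abs_le_max_abs_abs (ha x) (hc x)
  have hfi : Integrable f μ := integrable_of_bounded μ hf hC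
  constructor
  · have := integral_mono (integrable_const a) hfi ha
    rwa [integral_const, probReal_univ, one_smul] at this
  · have := integral_mono hfi (integrable_const c) hc
    rwa [integral_const, probReal_univ, one_smul] at this

/-- **… `≤ max(π f − a, c − π f)·r^b·min(N, w(x₀))`** (`S_N = w(x₀)(1 − r^N) ≤ min(N, w(x₀))`). [ours] -/
theorem abs_sum_Ico_integral_iterate_bind_indepMH_sub_le_min (hw : Measurable w) (hw0 : ∀ y, 0 < w y) {x₀ : Ω}
    (hmax : ∀ y, w y ≤ w x₀) [IsProbabilityMeasure (q.withDensity fun y => ENNReal.ofReal (w y))]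
    (μ₀ : Measure Ω) [IsProbabilityMeasure μ₀] {f : Ω → ℝ} (hf : Measurable f) {a c : ℝ}
    (ha : ∀ x, a ≤ f x) (hc : ∀ x, f x ≤ c) (b N : ℕ) :
    |∑ t ∈ Ico b (b + N), (∫ x, f x ∂((fun m : Measure Ω => m.bind (indepMH q w))^[t] μ₀) -
        ∫ x, f x ∂(q.withDensity fun y => ENNReal.ofReal (w y)))| ≤
      max (∫ x, f x ∂(q.withDensity fun y => ENNReal.ofReal (w y)) - a)
          (c - ∫ x, f x ∂(q.withDensity fun y => ENNReal.ofReal (w y))) *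
        ((1 - (w x₀)⁻¹) ^ b * min (N : ℝ) (w x₀)) := by
  refine (abs_sum_Ico_integral_iterate_bind_indepMH_sub_le (q := q) hw hw0 hmax μ₀ hf ha hc b N).trans ?_
  have hW : 1 ≤ w x₀ := one_le_of_mode (q := q) hmax
  have hr0 : 0 ≤ 1 - (w x₀)⁻¹ := sub_nonneg.2 (inv_le_one_of_one_le₀ hW)
  obtain ⟨hma, hmc⟩ := integral_mem_Icc_of_bounds (q.withDensity fun y => ENNReal.ofReal (w y)) hf ha hc
  have hmax0 : 0 ≤ max (∫ x, f x ∂(q.withDensity fun y => ENNReal.ofReal (w y)) - a)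
      (c - ∫ x, f x ∂(q.withDensity fun y => ENNReal.ofReal (w y))) := le_max_of_le_left (sub_nonneg.2 hma)
  refine mul_le_mul_of_nonneg_left (mul_le_mul_of_nonneg_left ?_ (pow_nonneg hr0 b)) hmax0
  exact le_min (geom_sum_mode_le_card (q := q) hw0 hmax N) (geom_sum_mode_le_weight (q := q) hw0 hmax N)

/-! ## §2 On path space: the window average after `b` discarded updates, from every start -/

/-- **The expected window average from any start is the average of the marginal expectations**:
`E_{μ₀}[(1/N)Σ_{i<N} f(X_{b+i})] = (1/N)Σ_{b ≤ t < b+N} ∫ f d(μ₀K^t)` (every Markov kernel). [ours, bookkeeping] -/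
theorem chain_windowAverage_eq_sum_integral_iterate_bind (κ : Kernel Ω Ω) [IsMarkovKernel κ] (μ₀ : Measure Ω)
    [IsProbabilityMeasure μ₀] {f : Ω → ℝ} (hf : Measurable f) {C : ℝ} (hC : ∀ x, |f x| ≤ C) (b N : ℕ) :
    ∫ x, (∑ i ∈ range N, f (x (b + i))) / N ∂(Kernel.trajMeasure (X := fun _ : ℕ => Ω) μ₀
        (fun n : ℕ => κ.comap (fun h : (i : ↥(Finset.Iic n)) → Ω => h ⟨n, Finset.mem_Iic.2 le_rfl⟩)
          (measurable_pi_apply _))) =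
      (∑ t ∈ Ico b (b + N), ∫ x, f x ∂((fun m : Measure Ω => m.bind κ)^[t] μ₀)) / N := by
  set P := Kernel.trajMeasure (X := fun _ : ℕ => Ω) μ₀
      (fun n : ℕ => κ.comap (fun h : (i : ↥(Finset.Iic n)) → Ω => h ⟨n, Finset.mem_Iic.2 le_rfl⟩)
        (measurable_pi_apply _)) with hP
  have hint : ∀ i, Integrable (fun x : ℕ → Ω => f (x (b + i))) P := fun i =>
    integrable_of_bounded P (hf.comp (measurable_pi_apply (b + i))) fun x => hC (x (b + i))
  rw [integral_div, integral_finsetSum _ fun i _ => hint i, Finset.sum_Ico_eq_sum_range, Nat.add_sub_cancel_left]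
  congr 1
  exact sum_congr rfl fun i _ => chain_expect_eq_integral_iterate_bind κ μ₀ hf hC (b + i)

/-- **THE WINDOW-AVERAGE BIAS FROM EVERY START**: for measurable `f` with `a ≤ f ≤ c`, every initial law `μ₀`,
every `b` and `N ≥ 1`: `E_{μ₀}[(1/N)Σ_{i<N} f(X_{b+i})] − π f ∈ [(a − π f)·r^b·S_N/N, (c − π f)·r^b·S_N/N]`. [ours] -/
theorem imh_chain_windowAverage_bias_anyStart_mem_Icc [Fact (Measurable w)] (hw0 : ∀ y, 0 < w y) {x₀ : Ω}
    (hmax : ∀ y, w y ≤ w x₀) [IsProbabilityMeasure (q.withDensity fun y => ENNReal.ofReal (w y))]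
    (μ₀ : Measure Ω) [IsProbabilityMeasure μ₀] {f : Ω → ℝ} (hf : Measurable f) {a c : ℝ}
    (ha : ∀ x, a ≤ f x) (hc : ∀ x, f x ≤ c) (b : ℕ) {N : ℕ} (hN : N ≠ 0) :
    ∫ x, (∑ i ∈ range N, f (x (b + i))) / N ∂(Kernel.trajMeasure (X := fun _ : ℕ => Ω) μ₀
        (fun n : ℕ => (indepMH q w).comap (fun h : (i : ↥(Finset.Iic n)) → Ω => h ⟨n, Finset.mem_Iic.2 le_rfl⟩)
          (measurable_pi_apply _))) - ∫ x, f x ∂(q.withDensity fun y => ENNReal.ofReal (w y)) ∈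
      Set.Icc ((a - ∫ x, f x ∂(q.withDensity fun y => ENNReal.ofReal (w y))) *
          ((1 - (w x₀)⁻¹) ^ b * ∑ t ∈ range N, (1 - (w x₀)⁻¹) ^ t) / N)
        ((c - ∫ x, f x ∂(q.withDensity fun y => ENNReal.ofReal (w y))) *
          ((1 - (w x₀)⁻¹) ^ b * ∑ t ∈ range N, (1 - (w x₀)⁻¹) ^ t) / N) := by
  have hC : ∀ x, |f x| ≤ max |a| |c| := fun x => abs_le_max_abs_abs (ha x) (hc x)
  have hNpos : (0 : ℝ) < N := by exact_mod_cast Nat.pos_of_ne_zero hN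
  obtain ⟨h1, h2⟩ := sum_Ico_integral_iterate_bind_indepMH_sub_mem_Icc (q := q) Fact.out hw0 hmax μ₀ hf ha hc b N
  rw [chain_windowAverage_eq_sum_integral_iterate_bind (indepMH q w) μ₀ hf hC b N]
  rw [Finset.sum_sub_distrib, Finset.sum_const, Nat.card_Ico, Nat.add_sub_cancel_left, nsmul_eq_mul] at h1 h2
  set S := ∑ t ∈ Ico b (b + N), ∫ x, f x ∂((fun m : Measure Ω => m.bind (indepMH q w))^[t] μ₀)
  set m := ∫ x, f x ∂(q.withDensity fun y => ENNReal.ofReal (w y))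
  have hkey : S / N - m = (S - N * m) / N := by field_simp
  rw [hkey]
  constructor
  · rw [div_le_div_iff_of_pos_right hNpos]; exact h1
  · rw [div_le_div_iff_of_pos_right hNpos]; exact h2

/-- **`|E_{μ₀}[window average] − π f| ≤ max(π f − a, c − π f)·r^b·min(1, w(x₀)/N)`** from every start (`N ≥ 1`):
the time-average bias decays like `w(x₀)/N = 1/(N·A)` times `r^b`, whatever the start. [ours] -/
theorem imh_chain_windowAverage_bias_anyStart_abs_le [Fact (Measurable w)] (hw0 : ∀ y, 0 < w y) {x₀ : Ω}
    (hmax : ∀ y, w y ≤ w x₀) [IsProbabilityMeasure (q.withDensity fun y => ENNReal.ofReal (w y))]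
    (μ₀ : Measure Ω) [IsProbabilityMeasure μ₀] {f : Ω → ℝ} (hf : Measurable f) {a c : ℝ}
    (ha : ∀ x, a ≤ f x) (hc : ∀ x, f x ≤ c) (b : ℕ) {N : ℕ} (hN : N ≠ 0) :
    |∫ x, (∑ i ∈ range N, f (x (b + i))) / N ∂(Kernel.trajMeasure (X := fun _ : ℕ => Ω) μ₀
        (fun n : ℕ => (indepMH q w).comap (fun h : (i : ↥(Finset.Iic n)) → Ω => h ⟨n, Finset.mem_Iic.2 le_rfl⟩)
          (measurable_pi_apply _))) - ∫ x, f x ∂(q.withDensity fun y => ENNReal.ofReal (w y))| ≤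
      max (∫ x, f x ∂(q.withDensity fun y => ENNReal.ofReal (w y)) - a)
          (c - ∫ x, f x ∂(q.withDensity fun y => ENNReal.ofReal (w y))) *
        ((1 - (w x₀)⁻¹) ^ b * min 1 (w x₀ / N)) := by
  have hC : ∀ x, |f x| ≤ max |a| |c| := fun x => abs_le_max_abs_abs (ha x) (hc x)
  have hNpos : (0 : ℝ) < N := by exact_mod_cast Nat.pos_of_ne_zero hN
  have h := abs_sum_Ico_integral_iterate_bind_indepMH_sub_le_min (q := q) Fact.out hw0 hmax μ₀ hf ha hc b N
  rw [chain_windowAverage_eq_sum_integral_iterate_bind (indepMH q w) μ₀ hf hC b N]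
  rw [Finset.sum_sub_distrib, Finset.sum_const, Nat.card_Ico, Nat.add_sub_cancel_left, nsmul_eq_mul] at h
  set S := ∑ t ∈ Ico b (b + N), ∫ x, f x ∂((fun m : Measure Ω => m.bind (indepMH q w))^[t] μ₀)
  set m := ∫ x, f x ∂(q.withDensity fun y => ENNReal.ofReal (w y))
  have hkey : S / N - m = (S - N * m) / N := by field_simp
  have hmin : min (N : ℝ) (w x₀) / N = min 1 (w x₀ / N) := by
    rcases le_total (N : ℝ) (w x₀) with hle | hle
    · rw [min_eq_left hle, div_self hNpos.ne', min_eq_left ((one_le_div hNpos).2 hle)]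
    · rw [min_eq_right hle, min_eq_right ((div_le_one hNpos).2 hle)]
  rw [hkey, abs_div, abs_of_pos hNpos, div_le_iff₀ hNpos, ← hmin]
  calc |S - N * m| ≤ _ := h
    _ = _ := by field_simp

/-- **THE BURN-IN RULE FROM EVERY START**: `log(1/ε) ≤ b/w(x₀)` discarded updates leave a window-average bias
`≤ ε·max(π f − a, c − π f)` for every window length `N ≥ 1` and every initial law. [ours] -/
theorem imh_chain_windowAverage_bias_anyStart_abs_le_of_log_le [Fact (Measurable w)] (hw0 : ∀ y, 0 < w y) {x₀ : Ω}
    (hmax : ∀ y, w y ≤ w x₀) [IsProbabilityMeasure (q.withDensity fun y => ENNReal.ofReal (w y))]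
    (μ₀ : Measure Ω) [IsProbabilityMeasure μ₀] {f : Ω → ℝ} (hf : Measurable f) {a c : ℝ}
    (ha : ∀ x, a ≤ f x) (hc : ∀ x, f x ≤ c) {b : ℕ} {N : ℕ} (hN : N ≠ 0) {ε : ℝ} (hε : 0 < ε)
    (hb : Real.log (1 / ε) ≤ b * (w x₀)⁻¹) :
    |∫ x, (∑ i ∈ range N, f (x (b + i))) / N ∂(Kernel.trajMeasure (X := fun _ : ℕ => Ω) μ₀
        (fun n : ℕ => (indepMH q w).comap (fun h : (i : ↥(Finset.Iic n)) → Ω => h ⟨n, Finset.mem_Iic.2 le_rfl⟩)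
          (measurable_pi_apply _))) - ∫ x, f x ∂(q.withDensity fun y => ENNReal.ofReal (w y))| ≤
      ε * max (∫ x, f x ∂(q.withDensity fun y => ENNReal.ofReal (w y)) - a)
          (c - ∫ x, f x ∂(q.withDensity fun y => ENNReal.ofReal (w y))) := by
  refine (imh_chain_windowAverage_bias_anyStart_abs_le (q := q) hw0 hmax μ₀ hf ha hc b hN).trans ?_
  obtain ⟨hma, hmc⟩ := integral_mem_Icc_of_bounds (q.withDensity fun y => ENNReal.ofReal (w y)) hf ha hc
  have hmax0 : 0 ≤ max (∫ x, f x ∂(q.withDensity fun y => ENNReal.ofReal (w y)) - a)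
      (c - ∫ x, f x ∂(q.withDensity fun y => ENNReal.ofReal (w y))) := le_max_of_le_left (sub_nonneg.2 hma)
  have hW : 1 ≤ w x₀ := one_le_of_mode (q := q) hmax
  have hr0 : 0 ≤ 1 - (w x₀)⁻¹ := sub_nonneg.2 (inv_le_one_of_one_le₀ hW)
  have hpow := pow_mode_le_of_log_le (q := q) hmax hε hb
  have hm1 : min 1 (w x₀ / N) ≤ 1 := min_le_left _ _
  have hm0 : 0 ≤ min 1 (w x₀ / N) := le_min zero_le_one (div_nonneg (hw0 x₀).le (Nat.cast_nonneg N))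
  calc _ ≤ max (∫ x, f x ∂(q.withDensity fun y => ENNReal.ofReal (w y)) - a)
          (c - ∫ x, f x ∂(q.withDensity fun y => ENNReal.ofReal (w y))) * (ε * 1) := by
        refine mul_le_mul_of_nonneg_left ?_ hmax0
        exact mul_le_mul hpow hm1 hm0 hε.le
    _ = _ := by ring

/-! ## §3 No start over-estimates an observable maximal at the mode more than the cold start -/

variable [MeasurableSingletonClass Ω]

/-- **The cold start's window-average bias, exactly** (GEN-31's `sum_Ico_integral_iterate_bind_indepMH_dirac_mode_sub`
on path space): `E_{x₀}[(1/N)Σ_{i<N} f(X_{b+i})] − π f = (f(x₀) − π f)·r^b·S_N/N`. [ours, bookkeeping] -/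
theorem imh_chain_windowAverage_bias_mode_eq [Fact (Measurable w)] (hw0 : ∀ y, 0 < w y) {x₀ : Ω}
    (hmax : ∀ y, w y ≤ w x₀) [IsProbabilityMeasure (q.withDensity fun y => ENNReal.ofReal (w y))]
    {f : Ω → ℝ} (hf : Measurable f) {C : ℝ} (hC : ∀ x, |f x| ≤ C) (b : ℕ) {N : ℕ} (hN : N ≠ 0) :
    ∫ x, (∑ i ∈ range N, f (x (b + i))) / N ∂(Kernel.trajMeasure (X := fun _ : ℕ => Ω) (Measure.dirac x₀)
        (fun n : ℕ => (indepMH q w).comap (fun h : (i : ↥(Finset.Iic n)) → Ω => h ⟨n, Finset.mem_Iic.2 le_rfl⟩)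
          (measurable_pi_apply _))) - ∫ x, f x ∂(q.withDensity fun y => ENNReal.ofReal (w y)) =
      (f x₀ - ∫ x, f x ∂(q.withDensity fun y => ENNReal.ofReal (w y))) *
        ((1 - (w x₀)⁻¹) ^ b * ∑ t ∈ range N, (1 - (w x₀)⁻¹) ^ t) / N := by
  have hNpos : (0 : ℝ) < N := by exact_mod_cast Nat.pos_of_ne_zero hN
  rw [chain_windowAverage_eq_sum_integral_iterate_bind (indepMH q w) (Measure.dirac x₀) hf hC b N,
    ← sum_Ico_integral_iterate_bind_indepMH_dirac_mode_sub Fact.out hw0 hmax b N (integrable_of_bounded _ hf hC),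
    Finset.sum_sub_distrib, Finset.sum_const, Nat.card_Ico, Nat.add_sub_cancel_left, nsmul_eq_mul]
  field_simp

/-- **NO START OVER-ESTIMATES AN OBSERVABLE MAXIMAL AT THE MODE MORE THAN THE COLD START**: if `a ≤ f ≤ f(x₀)`
(the plaquette, minus the action, every monotone function of the weight) then for every initial law `μ₀`, every `b`
and `N ≥ 1`: `E_{μ₀}[(1/N)Σ_{i<N} f(X_{b+i})] − π f ≤ E_{x₀}[(1/N)Σ_{i<N} f(X_{b+i})] − π f = (f(x₀) − π f)·r^b·S_N/N`
— GEN-31's exact cold-start bias is the largest signed bias over all initial laws. [ours] -/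
theorem imh_chain_windowAverage_bias_anyStart_le_cold [Fact (Measurable w)] (hw0 : ∀ y, 0 < w y) {x₀ : Ω}
    (hmax : ∀ y, w y ≤ w x₀) [IsProbabilityMeasure (q.withDensity fun y => ENNReal.ofReal (w y))]
    (μ₀ : Measure Ω) [IsProbabilityMeasure μ₀] {f : Ω → ℝ} (hf : Measurable f) {a : ℝ}
    (ha : ∀ x, a ≤ f x) (hfmax : ∀ x, f x ≤ f x₀) (b : ℕ) {N : ℕ} (hN : N ≠ 0) :
    ∫ x, (∑ i ∈ range N, f (x (b + i))) / N ∂(Kernel.trajMeasure (X := fun _ : ℕ => Ω) μ₀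
        (fun n : ℕ => (indepMH q w).comap (fun h : (i : ↥(Finset.Iic n)) → Ω => h ⟨n, Finset.mem_Iic.2 le_rfl⟩)
          (measurable_pi_apply _))) - ∫ x, f x ∂(q.withDensity fun y => ENNReal.ofReal (w y)) ≤
      ∫ x, (∑ i ∈ range N, f (x (b + i))) / N ∂(Kernel.trajMeasure (X := fun _ : ℕ => Ω) (Measure.dirac x₀)
        (fun n : ℕ => (indepMH q w).comap (fun h : (i : ↥(Finset.Iic n)) → Ω => h ⟨n, Finset.mem_Iic.2 le_rfl⟩)
          (measurable_pi_apply _))) - ∫ x, f x ∂(q.withDensity fun y => ENNReal.ofReal (w y)) := by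
  have hC : ∀ x, |f x| ≤ max |a| |f x₀| := fun x => abs_le_max_abs_abs (ha x) (hfmax x)
  rw [imh_chain_windowAverage_bias_mode_eq (q := q) hw0 hmax hf hC b hN]
  exact (imh_chain_windowAverage_bias_anyStart_mem_Icc (q := q) hw0 hmax μ₀ hf ha hfmax b hN).2

/-- **… and no start under-estimates an observable MINIMAL at the mode more than the cold start**: if
`f(x₀) ≤ f ≤ c` then `E_{x₀}[window average] − π f ≤ E_{μ₀}[window average] − π f` for every initial law. [ours] -/
theorem imh_chain_windowAverage_bias_anyStart_ge_cold [Fact (Measurable w)] (hw0 : ∀ y, 0 < w y) {x₀ : Ω}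
    (hmax : ∀ y, w y ≤ w x₀) [IsProbabilityMeasure (q.withDensity fun y => ENNReal.ofReal (w y))]
    (μ₀ : Measure Ω) [IsProbabilityMeasure μ₀] {f : Ω → ℝ} (hf : Measurable f) {c : ℝ}
    (hfmin : ∀ x, f x₀ ≤ f x) (hc : ∀ x, f x ≤ c) (b : ℕ) {N : ℕ} (hN : N ≠ 0) :
    ∫ x, (∑ i ∈ range N, f (x (b + i))) / N ∂(Kernel.trajMeasure (X := fun _ : ℕ => Ω) (Measure.dirac x₀)
        (fun n : ℕ => (indepMH q w).comap (fun h : (i : ↥(Finset.Iic n)) → Ω => h ⟨n, Finset.mem_Iic.2 le_rfl⟩)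
          (measurable_pi_apply _))) - ∫ x, f x ∂(q.withDensity fun y => ENNReal.ofReal (w y)) ≤
      ∫ x, (∑ i ∈ range N, f (x (b + i))) / N ∂(Kernel.trajMeasure (X := fun _ : ℕ => Ω) μ₀
        (fun n : ℕ => (indepMH q w).comap (fun h : (i : ↥(Finset.Iic n)) → Ω => h ⟨n, Finset.mem_Iic.2 le_rfl⟩)
          (measurable_pi_apply _))) - ∫ x, f x ∂(q.withDensity fun y => ENNReal.ofReal (w y)) := by
  have hC : ∀ x, |f x| ≤ max |f x₀| |c| := fun x => abs_le_max_abs_abs (hfmin x) (hc x)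
  rw [imh_chain_windowAverage_bias_mode_eq (q := q) hw0 hmax hf hC b hN]
  exact (imh_chain_windowAverage_bias_anyStart_mem_Icc (q := q) hw0 hmax μ₀ hf hfmin hc b hN).1

end Summit.Ventures.LatticeQCDFlow.Exactness

end
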